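import Summits.AtomisticToContinuum.HydrodynamicLimit.Theses.JParityClosure
import Literature.MathematicalPhysics.KineticTheory.MetropolisOddStatistic
import HarnessLib

/-!
# Detailed balance from ODD TESTS OF THE SURPRISAL JUMP (mixing-proof form of the parity mechanism)

Helper for the crux `JParityClosure.ParityBandClosure` (stmt-AtomisticToContinuum-17608), line `Sketch`, own stub
`stub_maxwellDefectVanishes`; lead's cycle-2 analysis (`Cruxes/ParityBandClosure/Lines/Sketch.dead.md`).

WHAT. Let `κ` be ANY measure on ANY measurable space (the limit collision record, possibly ALREADY SUMMED over a
Young-measure fibration of local velocity laws) and `F` a `κ`-integrable real function on it (the surprisal jump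
`log hh_*/h′h′_*` of the collision, each collision evaluated with the law of ITS OWN fibre). ASSUME
(balance) `∫ F dκ = 0`, and (odd jump tests) `∫ φ(F) · min(1, e^{−F}) dκ = 0` for every bounded continuous ODD
`φ : ℝ → ℝ`. THEN `F = 0` holds `κ`-a.e.: the Metropolis rejection mass `∫ (1 − min(1, e^{−F})) dκ` vanishes and
the record is detailed-balanced in every fibre (`ae_eq_zero_of_balance_of_odd_jump_tests`). A two-fibre form with
the balance and the odd tests only SUMMED over the fibres is `ae_eq_zero_of_balance_of_odd_jump_tests_two`.

WHY THIS FORM. The landed `stub_detailedBalanceOfSymmetricRecord` (p138663) takes the `J`-invariance of the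
reweighted record `min(1,e^{−F})·κ` under the inverse collision `J` — which the route's `OddContactSymmetry`
(stmt-17722) delivers only for the record AVERAGED over mesoscopic cells (its odd marks `Ψ(n̂, v, w)` are fixed test
functions, blind to which local law a collision happened in), and averaged `J`-invariance does NOT give detailed
balance fibrewise (two-fibre counter-model, `Lines/Sketch.dead.md` §2). Testing the same symmetry against odd
functions OF THE JUMP `F` itself needs no `J`-structure at all and survives the averaging: the whole argument is
one-dimensional in the jump value. This is the measure-level content a repaired 17722 (odd marks allowed to depend
on `F`) would feed.

PROOF. Clamp `F` at height `n` (`max (−n) (min · n)`, odd, bounded, continuous): the odd tests give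
`∫ clampₙ(F) min(1,e^{−F}) dκ = 0` for every `n`, and dominated convergence (bound `|F|`) gives
`∫ F min(1,e^{−F}) dκ = 0`. Subtracting from the balance, `∫ F (1 − min(1,e^{−F})) dκ = 0`, whose integrand is
`≥ 0` and vanishes exactly on `{F ≤ 0}`; so `F ≤ 0` a.e., and then `∫ F dκ = 0` forces `F = 0` a.e.

REFERENCES. C. Cercignani, R. Illner, M. Pulvirenti, *The Mathematical Theory of Dilute Gases* (1994), §3.2 (the
equality case of the H-theorem); W. K. Hastings, Biometrika 57 (1970) (acceptance `min(1, e^{−F})`).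
-/

noncomputable section

namespace Summit.AtomisticToContinuum.HydrodynamicLimit.Theorems.ParityBandClosureDetailedBalance

open MeasureTheory Filter Topology
open Literature.MathematicalPhysics.KineticTheory (minWeight_nonneg minWeight_le_one)

/-! ## §1 Scalar facts: the clamp and the Metropolis rejection factor -/

/-- The clamp `max (−n) (min a n)` is continuous in `a`. [folklore] -/
theorem continuous_clamp (n : ℝ) : Continuous fun a : ℝ => max (-n) (min a n) :=
  continuous_const.max (continuous_id.min continuous_const)

/-- The clamp at a natural height `n` is bounded by `n` (the real-height version is
`FouriersLaw.Theorems.CesaroUpgrade.abs_clamp_le`, not imported here). [folklore] -/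
theorem abs_clamp_natCast_le (n : ℕ) (a : ℝ) : |max (-(n : ℝ)) (min a n)| ≤ n := by
  have hn : (0 : ℝ) ≤ n := n.cast_nonneg
  rw [abs_le]
  exact ⟨le_max_left _ _, max_le (by linarith) (min_le_right _ _)⟩

/-- The clamp at a nonnegative height does not increase absolute values. [folklore] -/
theorem abs_clamp_le_abs {n : ℝ} (hn : 0 ≤ n) (a : ℝ) : |max (-n) (min a n)| ≤ |a| := by
  simp only [max_def, min_def]
  split_ifs <;> (try simp) <;> rw [abs_le] <;> constructor <;>
    cases abs_cases a <;> linarith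

/-- The clamp at a nonnegative height is odd. [folklore] -/
theorem clamp_neg {n : ℝ} (hn : 0 ≤ n) (a : ℝ) : max (-n) (min (-a) n) = -max (-n) (min a n) := by
  simp only [max_def, min_def]
  split_ifs <;> linarith

/-- Above the height `|a|` the clamp is the identity. [folklore] -/
theorem clamp_eq_self {n a : ℝ} (h : |a| ≤ n) : max (-n) (min a n) = a := by
  rw [abs_le] at h
  rw [min_eq_left h.2, max_eq_right h.1]

-- The weight bounds `0 ≤ min(1, e^{−a}) ≤ 1` are the Literature's `minWeight_nonneg` / `minWeight_le_one`
-- (`MetropolisOddStatistic.lean`, the file naming the statistic of `OddContactSymmetry`).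

/-- For a downhill jump `a ≤ 0` the move is always accepted: `min(1, e^{−a}) = 1`. [folklore] -/
theorem metropolis_eq_one_of_nonpos {a : ℝ} (ha : a ≤ 0) : min 1 (Real.exp (-a)) = 1 :=
  min_eq_left (Real.one_le_exp_iff.2 (neg_nonneg.2 ha))

/-- The rejection integrand `a · (1 − min(1, e^{−a}))` is nonnegative. [folklore] -/
theorem mul_rejection_nonneg (a : ℝ) : 0 ≤ a * (1 - min 1 (Real.exp (-a))) := by
  rcases le_total a 0 with ha | ha
  · rw [metropolis_eq_one_of_nonpos ha, sub_self, mul_zero]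
  · exact mul_nonneg ha (sub_nonneg.2 (minWeight_le_one a))

/-- The rejection integrand `a · (1 − min(1, e^{−a}))` is positive for an uphill jump `a > 0`. [folklore] -/
theorem mul_rejection_pos {a : ℝ} (ha : 0 < a) : 0 < a * (1 - min 1 (Real.exp (-a))) := by
  refine mul_pos ha (sub_pos.2 ?_)
  have h : Real.exp (-a) < 1 := by
    rw [← Real.exp_zero]
    exact Real.exp_lt_exp.2 (neg_neg_of_pos ha)
  rw [min_eq_right h.le]
  exact h

/-! ## §2 From odd jump tests to `∫ F · min(1, e^{−F}) dκ = 0` (dominated convergence) -/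

variable {α : Type*} [MeasurableSpace α]

/-- The clamped, reweighted jumps converge in `L¹`-mean: `∫ clampₙ(F) min(1,e^{−F}) dκ → ∫ F min(1,e^{−F}) dκ`
(dominated convergence with bound `|F|`). [folklore] -/
theorem tendsto_integral_clamp_mul_metropolis (κ : Measure α) (F : α → ℝ) (hF : Integrable F κ) :
    Tendsto (fun n : ℕ => ∫ x, max (-(n : ℝ)) (min (F x) n) * min 1 (Real.exp (-F x)) ∂κ) atTop
      (𝓝 (∫ x, F x * min 1 (Real.exp (-F x)) ∂κ)) := by
  have hw : Continuous fun a : ℝ => min 1 (Real.exp (-a)) :=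
    continuous_const.min (Real.continuous_exp.comp continuous_neg)
  refine tendsto_integral_of_dominated_convergence (fun x => |F x|) (fun n => ?_) hF.abs (fun n => ?_) ?_
  · exact (((continuous_clamp (n : ℝ)).mul hw).comp_aestronglyMeasurable hF.aestronglyMeasurable :)
  · refine ae_of_all _ fun x => ?_
    rw [Real.norm_eq_abs, abs_mul, abs_of_nonneg (minWeight_nonneg _)]
    calc |max (-(n : ℝ)) (min (F x) n)| * min 1 (Real.exp (-F x))
        ≤ |F x| * 1 := mul_le_mul (abs_clamp_le_abs n.cast_nonneg _) (minWeight_le_one _)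
          (minWeight_nonneg _) (abs_nonneg _)
      _ = |F x| := mul_one _
  · refine ae_of_all _ fun x => ?_
    refine tendsto_atTop_of_eventually_const (i₀ := ⌈|F x|⌉₊) fun n hn => ?_
    rw [clamp_eq_self]
    exact (Nat.le_ceil _).trans (by exact_mod_cast hn)

/-- **Odd jump tests kill the reweighted first moment.** If `∫ φ(F) min(1,e^{−F}) dκ = 0` for every bounded
continuous odd `φ`, then `∫ F min(1,e^{−F}) dκ = 0` (`F` integrable). [folklore] -/
theorem integral_mul_metropolis_eq_zero_of_odd_jump_tests (κ : Measure α) (F : α → ℝ) (hF : Integrable F κ)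
    (hodd : ∀ φ : ℝ → ℝ, Continuous φ → (∃ C : ℝ, ∀ a, |φ a| ≤ C) → (∀ a, φ (-a) = -φ a) →
      ∫ x, φ (F x) * min 1 (Real.exp (-F x)) ∂κ = 0) :
    ∫ x, F x * min 1 (Real.exp (-F x)) ∂κ = 0 := by
  have hlim := tendsto_integral_clamp_mul_metropolis κ F hF
  have h0 : ∀ n : ℕ, ∫ x, max (-(n : ℝ)) (min (F x) n) * min 1 (Real.exp (-F x)) ∂κ = 0 := fun n =>
    hodd (fun a => max (-(n : ℝ)) (min a n)) (continuous_clamp n) ⟨n, abs_clamp_natCast_le n⟩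
      (clamp_neg n.cast_nonneg)
  simp_rw [h0] at hlim
  exact tendsto_nhds_unique tendsto_const_nhds hlim ▸ rfl

/-! ## §3 Sign bookkeeping -/

/-- The rejection-weighted jump `F (1 − min(1,e^{−F}))` is integrable when `F` is. [folklore] -/
theorem integrable_mul_rejection (κ : Measure α) (F : α → ℝ) (hF : Integrable F κ) :
    Integrable (fun x => F x * (1 - min 1 (Real.exp (-F x)))) κ := by
  have hw : Continuous fun a : ℝ => a * (1 - min 1 (Real.exp (-a))) :=
    continuous_id.mul (continuous_const.sub (continuous_const.min (Real.continuous_exp.comp continuous_neg)))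
  refine hF.abs.mono' (hw.comp_aestronglyMeasurable hF.aestronglyMeasurable) (ae_of_all _ fun x => ?_)
  rw [Real.norm_eq_abs, abs_mul]
  calc |F x| * |1 - min 1 (Real.exp (-F x))| ≤ |F x| * 1 := by
        refine mul_le_mul_of_nonneg_left ?_ (abs_nonneg _)
        rw [abs_of_nonneg (sub_nonneg.2 (minWeight_le_one _))]
        linarith [minWeight_nonneg (F x)]
    _ = |F x| := mul_one _

/-- The reweighted jump `F min(1,e^{−F})` is integrable when `F` is. [folklore] -/
theorem integrable_mul_metropolis (κ : Measure α) (F : α → ℝ) (hF : Integrable F κ) :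
    Integrable (fun x => F x * min 1 (Real.exp (-F x))) κ := by
  have h := hF.sub (integrable_mul_rejection κ F hF)
  refine h.congr (ae_of_all _ fun x => ?_)
  simp only [Pi.sub_apply]
  ring

/-- If the rejection functional `∫ F (1 − min(1,e^{−F})) dκ` vanishes then there are no uphill jumps:
`F ≤ 0` a.e. [folklore] -/
theorem ae_nonpos_of_integral_mul_rejection_eq_zero (κ : Measure α) (F : α → ℝ) (hF : Integrable F κ)
    (h : ∫ x, F x * (1 - min 1 (Real.exp (-F x))) ∂κ = 0) : ∀ᵐ x ∂κ, F x ≤ 0 := by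
  have hnn : 0 ≤ᵐ[κ] fun x => F x * (1 - min 1 (Real.exp (-F x))) :=
    ae_of_all _ fun x => mul_rejection_nonneg (F x)
  have hz := (integral_eq_zero_iff_of_nonneg_ae hnn (integrable_mul_rejection κ F hF)).1 h
  filter_upwards [hz] with x hx
  by_contra hpos
  push Not at hpos
  exact (mul_rejection_pos hpos).ne' hx

/-- A nonpositive integrable function with zero integral vanishes a.e. [folklore] -/
theorem ae_eq_zero_of_nonpos_of_integral_eq_zero (κ : Measure α) (F : α → ℝ) (hF : Integrable F κ)
    (hle : ∀ᵐ x ∂κ, F x ≤ 0) (h : ∫ x, F x ∂κ = 0) : ∀ᵐ x ∂κ, F x = 0 := by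
  have hnn : 0 ≤ᵐ[κ] fun x => -F x := by filter_upwards [hle] with x hx using neg_nonneg.2 hx
  have hint : ∫ x, -F x ∂κ = 0 := by rw [integral_neg, h, neg_zero]
  have hz := (integral_eq_zero_iff_of_nonneg_ae hnn hF.neg).1 hint
  filter_upwards [hz] with x hx
  simpa using hx

/-! ## §4 The detailed-balance theorems -/

/-- **Detailed balance from balance and odd jump tests (one record).** For any measure `κ` and `κ`-integrable jump
`F`: if `∫ F dκ = 0` and `∫ φ(F) min(1,e^{−F}) dκ = 0` for every bounded continuous odd `φ`, then `F = 0` `κ`-a.e.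
(so the rejection mass `∫ (1 − min(1,e^{−F})) dκ` of every sub-record vanishes). No `J`-structure and no
finiteness of `κ` is used. [cite: CIP1994, §3.2] -/
theorem ae_eq_zero_of_balance_of_odd_jump_tests (κ : Measure α) (F : α → ℝ) (hF : Integrable F κ)
    (hbal : ∫ x, F x ∂κ = 0)
    (hodd : ∀ φ : ℝ → ℝ, Continuous φ → (∃ C : ℝ, ∀ a, |φ a| ≤ C) → (∀ a, φ (-a) = -φ a) →
      ∫ x, φ (F x) * min 1 (Real.exp (-F x)) ∂κ = 0) :
    ∀ᵐ x ∂κ, F x = 0 := by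
  have hA := integral_mul_metropolis_eq_zero_of_odd_jump_tests κ F hF hodd
  have hrej : ∫ x, F x * (1 - min 1 (Real.exp (-F x))) ∂κ = 0 := by
    have hsub := integral_sub hF (integrable_mul_metropolis κ F hF)
    rw [hbal, hA, sub_zero] at hsub
    rw [← hsub]
    refine integral_congr_ae (ae_of_all _ fun x => ?_)
    ring
  exact ae_eq_zero_of_nonpos_of_integral_eq_zero κ F hF
    (ae_nonpos_of_integral_mul_rejection_eq_zero κ F hF hrej) hbal

/-- **Detailed balance in EVERY fibre from FIBRE-SUMMED balance and odd jump tests (two records).** Two records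
`κ₁, κ₂` (on possibly different spaces) with integrable jumps `F₁, F₂`; only the SUMS `∫ F₁ dκ₁ + ∫ F₂ dκ₂ = 0` and
`∫ φ(F₁) min(1,e^{−F₁}) dκ₁ + ∫ φ(F₂) min(1,e^{−F₂}) dκ₂ = 0` (bounded continuous odd `φ`) are assumed — the form a
fixed-test (`χ`-averaged) hypothesis delivers after Young-measure mixing of two cell types. STILL `F₁ = 0` `κ₁`-a.e.
and `F₂ = 0` `κ₂`-a.e. Contrast: the same averaging applied to `J`-invariance of the reweighted records does not give
fibrewise detailed balance (`Lines/Sketch.dead.md` §2). [cite: CIP1994, §3.2] -/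
theorem ae_eq_zero_of_balance_of_odd_jump_tests_two {β : Type*} [MeasurableSpace β] (κ₁ : Measure α)
    (κ₂ : Measure β) (F₁ : α → ℝ) (F₂ : β → ℝ) (h₁ : Integrable F₁ κ₁) (h₂ : Integrable F₂ κ₂)
    (hbal : ∫ x, F₁ x ∂κ₁ + ∫ y, F₂ y ∂κ₂ = 0)
    (hodd : ∀ φ : ℝ → ℝ, Continuous φ → (∃ C : ℝ, ∀ a, |φ a| ≤ C) → (∀ a, φ (-a) = -φ a) →
      ∫ x, φ (F₁ x) * min 1 (Real.exp (-F₁ x)) ∂κ₁ + ∫ y, φ (F₂ y) * min 1 (Real.exp (-F₂ y)) ∂κ₂ = 0) :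
    (∀ᵐ x ∂κ₁, F₁ x = 0) ∧ (∀ᵐ y ∂κ₂, F₂ y = 0) := by
  -- the summed reweighted first moment vanishes (dominated convergence in each record)
  have hlim := (tendsto_integral_clamp_mul_metropolis κ₁ F₁ h₁).add
    (tendsto_integral_clamp_mul_metropolis κ₂ F₂ h₂)
  have h0 : ∀ n : ℕ, (∫ x, max (-(n : ℝ)) (min (F₁ x) n) * min 1 (Real.exp (-F₁ x)) ∂κ₁) +
      ∫ y, max (-(n : ℝ)) (min (F₂ y) n) * min 1 (Real.exp (-F₂ y)) ∂κ₂ = 0 := fun n =>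
    hodd (fun a => max (-(n : ℝ)) (min a n)) (continuous_clamp n) ⟨n, abs_clamp_natCast_le n⟩
      (clamp_neg n.cast_nonneg)
  simp_rw [h0] at hlim
  have hA : (∫ x, F₁ x * min 1 (Real.exp (-F₁ x)) ∂κ₁) + ∫ y, F₂ y * min 1 (Real.exp (-F₂ y)) ∂κ₂ = 0 :=
    (tendsto_nhds_unique tendsto_const_nhds hlim).symm
  -- the two rejection functionals are nonnegative and sum to zero
  have hr₁ : ∫ x, F₁ x * (1 - min 1 (Real.exp (-F₁ x))) ∂κ₁ =
      (∫ x, F₁ x ∂κ₁) - ∫ x, F₁ x * min 1 (Real.exp (-F₁ x)) ∂κ₁ := by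
    rw [← integral_sub h₁ (integrable_mul_metropolis κ₁ F₁ h₁)]
    refine integral_congr_ae (ae_of_all _ fun x => ?_)
    ring
  have hr₂ : ∫ y, F₂ y * (1 - min 1 (Real.exp (-F₂ y))) ∂κ₂ =
      (∫ y, F₂ y ∂κ₂) - ∫ y, F₂ y * min 1 (Real.exp (-F₂ y)) ∂κ₂ := by
    rw [← integral_sub h₂ (integrable_mul_metropolis κ₂ F₂ h₂)]
    refine integral_congr_ae (ae_of_all _ fun y => ?_)
    ring
  have hn₁ : 0 ≤ ∫ x, F₁ x * (1 - min 1 (Real.exp (-F₁ x))) ∂κ₁ :=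
    integral_nonneg fun x => mul_rejection_nonneg (F₁ x)
  have hn₂ : 0 ≤ ∫ y, F₂ y * (1 - min 1 (Real.exp (-F₂ y))) ∂κ₂ :=
    integral_nonneg fun y => mul_rejection_nonneg (F₂ y)
  have hsum : (∫ x, F₁ x * (1 - min 1 (Real.exp (-F₁ x))) ∂κ₁) +
      ∫ y, F₂ y * (1 - min 1 (Real.exp (-F₂ y))) ∂κ₂ = 0 := by
    rw [hr₁, hr₂]; linarith
  have hz₁ : ∫ x, F₁ x * (1 - min 1 (Real.exp (-F₁ x))) ∂κ₁ = 0 := by linarith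
  have hz₂ : ∫ y, F₂ y * (1 - min 1 (Real.exp (-F₂ y))) ∂κ₂ = 0 := by linarith
  have hle₁ := ae_nonpos_of_integral_mul_rejection_eq_zero κ₁ F₁ h₁ hz₁
  have hle₂ := ae_nonpos_of_integral_mul_rejection_eq_zero κ₂ F₂ h₂ hz₂
  -- nonpositive jumps with summed balance zero: each balance is zero
  have hi₁ : ∫ x, F₁ x ∂κ₁ ≤ 0 := integral_nonpos_of_ae hle₁
  have hi₂ : ∫ y, F₂ y ∂κ₂ ≤ 0 := integral_nonpos_of_ae hle₂
  exact ⟨ae_eq_zero_of_nonpos_of_integral_eq_zero κ₁ F₁ h₁ hle₁ (by linarith),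
    ae_eq_zero_of_nonpos_of_integral_eq_zero κ₂ F₂ h₂ hle₂ (by linarith)⟩

/-! ## §5 Registered sub-goals (stub form: `theorem name : signature`, universe-`0` spaces) -/

/-- REGISTERED SUB-GOAL `stub_jumpDetailedBalance` of `stub_maxwellDefectVanishes` (crux stmt-AtomisticToContinuum-17608):
detailed balance from balance and odd jump tests, `ae_eq_zero_of_balance_of_odd_jump_tests` in stub form.
[cite: CIP1994, §3.2] -/
theorem stub_jumpDetailedBalance : ∀ {α : Type} [MeasurableSpace α] (κ : Measure α) (F : α → ℝ), Integrable F κ → ∫ x, F x ∂κ = 0 → (∀ φ : ℝ → ℝ, Continuous φ → (∃ C : ℝ, ∀ a, |φ a| ≤ C) → (∀ a, φ (-a) = -φ a) → ∫ x, φ (F x) * min 1 (Real.exp (-F x)) ∂κ = 0) → ∀ᵐ x ∂κ, F x = 0 :=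
  fun κ F hF hbal hodd => ae_eq_zero_of_balance_of_odd_jump_tests κ F hF hbal hodd

/-- REGISTERED SUB-GOAL `stub_jumpDetailedBalanceTwoFibre` of `stub_maxwellDefectVanishes` (crux
stmt-AtomisticToContinuum-17608): the two-fibre (mixing-proof) form, `ae_eq_zero_of_balance_of_odd_jump_tests_two` in
stub form. [cite: CIP1994, §3.2] -/
theorem stub_jumpDetailedBalanceTwoFibre : ∀ {α β : Type} [MeasurableSpace α] [MeasurableSpace β] (κ₁ : Measure α) (κ₂ : Measure β) (F₁ : α → ℝ) (F₂ : β → ℝ), Integrable F₁ κ₁ → Integrable F₂ κ₂ → (∫ x, F₁ x ∂κ₁ + ∫ y, F₂ y ∂κ₂ = 0) → (∀ φ : ℝ → ℝ, Continuous φ → (∃ C : ℝ, ∀ a, |φ a| ≤ C) → (∀ a, φ (-a) = -φ a) → ∫ x, φ (F₁ x) * min 1 (Real.exp (-F₁ x)) ∂κ₁ + ∫ y, φ (F₂ y) * min 1 (Real.exp (-F₂ y)) ∂κ₂ = 0) → (∀ᵐ x ∂κ₁, F₁ x = 0) ∧ (∀ᵐ y ∂κ₂, F₂ y = 0) :=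
  fun κ₁ κ₂ F₁ F₂ h₁ h₂ hbal hodd => ae_eq_zero_of_balance_of_odd_jump_tests_two κ₁ κ₂ F₁ F₂ h₁ h₂ hbal hodd

end Summit.AtomisticToContinuum.HydrodynamicLimit.Theorems.ParityBandClosureDetailedBalance

end
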